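import Literature.ModelTheory.ExponentialFields.DefinableAlgebraicNumbersZilberProofs
import HarnessLib

/-!
# KMO 2012, Theorem 2 (automorphism form) in every universe: `KMO2012_exists_equiv_apply_ne` holds

J. Kirby, A. Macintyre, A. Onshuus, *The algebraic numbers definable in various exponential
fields*, J. Inst. Math. Jussieu 11 (2012) 825–834 (arXiv:1101.4224), §3.5 (Proposition), §3.7
(proof of Theorem 2), §3.8.

Third proofs file of `DefinableAlgebraicNumbers.lean`. `DefinableAlgebraicNumbersZilberProofs.lean`
proves the automorphism form of Theorem 2 for countable Zilber fields in every universe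
(`KMO2012.exists_equiv_apply_ne_of_countable`) and reduces the general statement in universe `u`
to the extension of automorphisms of the prime model `ecl(∅)` of uncountable Zilber fields in
`Type u` (`KMO2012.exists_equiv_apply_ne_of_extend_eclEmpty`), which it proves for `Type` only
(`KMO2012.exists_equiv_extend_eclEmpty₀`, written when the quasiminimal pregeometry class
`ZilberClosedClassOver` of the tree's categoricity proof was a class of structures in `Type`).
That class and its language `Language.eclIsoOver P` are now universe polymorphic
(`ZilberCategoricityOver.lean`, `ZilberHomogeneityTransfer.lean`, `ZilberClosedClassOver.lean`:
base, carriers and members in one arbitrary universe `u`), so the same argument runs in every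
universe:

* `KMO2012.exists_equiv_extend_eclEmpty` — automorphisms of the prime model of an uncountable
  Zilber field in `Type u` extend to automorphisms of the field (two base points `incl`,
  `incl ∘ θ`; Kirby 2010 Thm 3.3 / Haykazyan 2016 Thm 16 in the form
  `IsQuasiminimalPregeometryClass.nonempty_equiv_of_mk_eq'`);
* `KMO2012_exists_equiv_apply_ne_holds` — **the named fact `KMO2012_exists_equiv_apply_ne`, proved
  in every universe** (net debt −1).

## References

* J. Kirby, A. Macintyre, A. Onshuus, J. Inst. Math. Jussieu 11 (2012) 825–834, arXiv:1101.4224: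
  §3.5 Proposition, §3.7, §3.8.
* J. Kirby, *On quasiminimal excellent classes*, J. Symbolic Logic 75 (2010) 551–564: Thm 3.3.
* L. Haykazyan, J. Symbolic Logic 81 (2016) 56–64: Thm 16.
* M. Bays, J. Kirby, arXiv:1305.0493 (2013): Props 4–5; Algebra & Number Theory 12 (2018): Thm 9.1.
-/

noncomputable section

open scoped Cardinal
open Set

universe u

namespace Literature.ModelTheory.ExponentialFields

open Literature.NumberTheory.Transcendental

namespace KMO2012

/-! ### Automorphisms of the prime model of an uncountable Zilber field extend, in every universe -/

section PrimeModel

open FirstOrder Literature.ModelTheory.Quasiminimal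

/-- **Automorphisms of the prime model extend, in every universe** (the §3.5 Proposition of KMO
for `F₀` inside `ecl(∅)`, uncountable case: every automorphism `θ` of the countable `ecl`-closed
E-subfield `ecl^K(∅)` of an uncountable Zilber field `K` in `Type u` extends to an automorphism of
the exponential field `K`). Proof as for `exists_equiv_extend_eclEmpty₀` (the case `u = 0`), in
the universe-polymorphic class `ZilberClosedClassOver P`, `P = ecl^K(∅)`: the two base
points `ι = incl`, `ι' = incl ∘ θ` make `K` two uncountable members of the same cardinality, which
are isomorphic (`IsQuasiminimalPregeometryClass.nonempty_equiv_of_mk_eq'`: Kirby 2010 Thm 3.3 /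
Haykazyan 2016 Thm 16), and the isomorphism intertwines the base points, i.e. extends `θ`.
[cite: KirbyMacintyreOnshuus2012, §3.5 Proposition (proof sketch)] [cite: Kirby2010QMEC, Thm 3.3]
[cite: Haykazyan2016, Theorem 16] -/
theorem exists_equiv_extend_eclEmpty {K : Type u} [Field K] [CharZero K] [ExponentialRing K]
    (hK : IsZilberField K) (hKu : ℵ₀ < #K)
    (θ : ExponentialRingEquiv (Khovanskii.eclSubfield (∅ : Set K))
      (Khovanskii.eclSubfield (∅ : Set K))) :
    ∃ ρ : ExponentialRingEquiv K K, ∀ x : Khovanskii.eclSubfield (∅ : Set K), ρ x = θ x := by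
  classical
  haveI : Uncountable K := Cardinal.aleph0_lt_mk_iff.1 hKu
  let P : Type u := Khovanskii.eclSubfield (∅ : Set K)
  let ι₁ : ExponentialRingHom P K := Khovanskii.eclSubfield.eHom (∅ : Set K)
  let ι₂ : ExponentialRingHom P K := ι₁.comp θ.toExponentialRingHom
  let bp₁ : EclBasePoint P K := ⟨ι₁⟩
  let bp₂ : EclBasePoint P K := ⟨ι₂⟩
  let S₁ : (Language.eclIsoOver P).Structure K :=
    @Language.eclIsoOver.instStructure P _ _ K _ _ bp₁
  let S₂ : (Language.eclIsoOver P).Structure K :=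
    @Language.eclIsoOver.instStructure P _ _ K _ _ bp₂
  have hι₁ : Set.range ι₁ = ecl (∅ : Set K) := by
    ext a
    constructor
    · rintro ⟨p, rfl⟩; exact p.2
    · intro ha; exact ⟨⟨a, ha⟩, rfl⟩
  have hι₂ : Set.range ι₂ = ecl (∅ : Set K) := by
    ext a
    constructor
    · rintro ⟨p, rfl⟩; exact (θ p).2
    · intro ha
      refine ⟨θ.symm ⟨a, ha⟩, ?_⟩
      change ((θ (θ.symm ⟨a, ha⟩) : Khovanskii.eclSubfield (∅ : Set K)) : K) = a
      rw [θ.apply_symm_apply]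
  have hH₁ : @ZilberClosedClassOver P _ _ K S₁ ecl :=
    @zilberClosedClassOver_of_isZilberField P _ _ K _ _ _ bp₁ hK hKu hι₁
  have hH₂ : @ZilberClosedClassOver P _ _ K S₂ ecl :=
    @zilberClosedClassOver_of_isZilberField P _ _ K _ _ _ bp₂ hK hKu hι₂
  obtain ⟨e⟩ := @IsQuasiminimalPregeometryClass.nonempty_equiv_of_mk_eq'
    (Language.eclIsoOver P) (ZilberClosedClassOver P) K K S₁ S₂ ecl ecl
    (ZilberClosedClassOver.isQuasiminimalPregeometryClass (P := P)) hH₁ hH₂ inferInstance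
    rfl
  refine ⟨@ExponentialRingEquiv.ofEclIsoOverEquiv P _ _ K K _ _ bp₁ _ _ bp₂ e, fun x => ?_⟩
  change e (x : K) = (θ x : K)
  -- the relation symbol of the pointed prime model `(ecl(x), x, ι₁)` transported along `e`
  have hιecl : ∀ p : P, @basePt P _ _ K _ _ bp₁ p ∈ ecl (∅ : Set K) := fun p => p.2
  have h1 := @relMap_self_over P _ _ K _ _ bp₁ hιecl 1 ![(x : K)]
  have h2 := (@Language.Equiv.map_rel (Language.eclIsoOver P) K K S₁ S₂ e 1
    (@PointedEFieldOver.self P _ _ K _ _ bp₁ hιecl 1 ![(x : K)]) ![(x : K)]).2 h1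
  obtain ⟨φ, -, hφpt, hφb⟩ :=
    (@Language.eclIsoOver.relMap_iff P _ _ K _ _ bp₂ 1 _ _).1 h2
  have h3 := congr_fun hφpt 0
  have h4 := hφb x
  simp only [Function.comp_apply, Matrix.cons_val_zero] at h3
  have h5 : (@PointedEFieldOver.self P _ _ K _ _ bp₁ hιecl 1 ![(x : K)]).pt 0 =
      (@PointedEFieldOver.self P _ _ K _ _ bp₁ hιecl 1 ![(x : K)]).base x :=
    Subtype.ext rfl
  rw [h5, h4] at h3
  exact h3.symm

end PrimeModel

/-! ### The named fact, in every universe -/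

/-- **KMO 2012, Theorem 2 (automorphism form, §3.7–3.8): in a Zilber field with the countable
closure property, every algebraic number which is not real abelian is moved by an automorphism of
the exponential field — the named fact `KMO2012_exists_equiv_apply_ne` HOLDS, in every universe.**
From `exists_equiv_apply_ne_of_extend_eclEmpty` (countable fields: KMO §3.7 through the countable
case of the §3.5 Proposition; uncountable fields: move `α` inside the countable Zilber field
`ecl(∅)` and extend) and `exists_equiv_extend_eclEmpty`.
[cite: KirbyMacintyreOnshuus2012, §3.7 (proof of Theorem 2) and §3.8] -/
theorem _root_.Literature.ModelTheory.ExponentialFields.KMO2012_exists_equiv_apply_ne_holds :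
    KMO2012_exists_equiv_apply_ne :=
  exists_equiv_apply_ne_of_extend_eclEmpty fun _ _ _ _ hK hKu θ =>
    exists_equiv_extend_eclEmpty hK hKu θ

end KMO2012

end Literature.ModelTheory.ExponentialFields

end
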